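import Summits.KontsevichZagierPeriods.KontsevichZagierPeriods.Theorems.FermatIsogenyBetaLinearSectorStubUpperSectorAux
import Summits.KontsevichZagierPeriods.KontsevichZagierPeriods.Theorems.FermatIsogenyBetaLinearSectorStubSectorChart
import Summits.KontsevichZagierPeriods.KontsevichZagierPeriods.Theorems.FermatIsogenyBetaLinearSectorStubSectorPaths
import Summits.KontsevichZagierPeriods.KontsevichZagierPeriods.Theorems.FermatIsogenyBetaLinearSectorStubSectorLoopZ
import Summits.KontsevichZagierPeriods.KontsevichZagierPeriods.Theorems.FermatIsogenyBetaLinearSectorStubSectorLoopInfinity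
import Summits.KontsevichZagierPeriods.KontsevichZagierPeriods.Theorems.FermatIsogenyBetaLinearSectorStubTransportInvY
import Literature.NumberTheory.Transcendental.CurvePeriodsPathCalculusProofs
import Mathlib.Tactic.Module
import HarnessLib

/-!
# `BetaLinearSector` (stmt-KontsevichZagierPeriods-3897) — section `Sector`: THE UPPER SECTOR RELATION

Registered stub `stub_upperSector` of line `fermat-sector-transport` (lead c4): for positive `r, s, t` with `r + s + t = N`,

  `(F_N, ω_{r,s}, γ_N) − ε̄^s (F_N, ω_{t,s}, γ_N) − ε^r (F_N, ω_{r,t}, γ_N) ∼ 0`   (`ε = e^{iπ/N}`),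

i.e. on periods `B(a,b) = e^{−iπb} B(1−a−b, b) + e^{iπa} B(a, 1−a−b)`, `a = r/N`, `b = s/N` — Cauchy's theorem on the sector
`{0 ≤ arg x ≤ π/N}` of one sheet of `F_N(ℂ)` as an EXPLICIT elementary decomposition: the null-homotopic loop in the affine
chart (`stub_sectorLoopZ` on the chart facts `stub_sectorChart` and the paths `stub_sectorPaths`), the null-homotopic loop in
the chart at infinity (`stub_sectorLoopInfinity`), glued by the transports `stub_transportInvX` (along `g₂ = (1/x, εy/x)`, for
the branch `e₂` and the frontier `f`), `stub_transportInvY` (along `g₃ = (ε̄x/y, 1/y)`, for the ray `e₃`),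
`upperSector_transportInvYX` (along `g₂ ∘ swap`, for the ray `d₃` at infinity), and two subdivisions of `γ_N` at `t = 1/2`.

References: B. Gross (appendix by D. Rohrlich), Invent. Math. 45 (1978), §1; A. Huber, G. Wüstholz, *Transcendence and
linear relations of 1-periods* (2022), §3.3.1, §13.1.
-/

noncomputable section

namespace Summit.KontsevichZagierPeriods.FermatIsogeny.BetaLinearSector

open scoped BigOperators
open MeasureTheory Set MvPolynomial
open Literature.NumberTheory.Transcendental Literature.NumberTheory.Transcendental.CurvePeriods

/-- **THE UPPER SECTOR RELATION** (registered stub `stub_upperSector`): for positive `r, s, t` with `r + s + t = N`,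
`(F_N, ω_{r,s}, γ_N) − ε̄^s (F_N, ω_{t,s}, γ_N) − ε^r (F_N, ω_{r,t}, γ_N)` is an algebraic combination of elementary relations
— Cauchy's theorem on the sector `{0 ≤ arg x ≤ π/N}` of one sheet of `F_N(ℂ)`; on periods:
`B(a,b) = e^{−iπb} B(1−a−b, b) + e^{iπa} B(a, 1−a−b)`. [cite: Gross1978, §1 (Rohrlich's appendix)] -/
theorem stub_upperSector : ∀ (N r s t : ℕ), 3 ≤ N → 1 ≤ r → 1 ≤ s → 1 ≤ t → r + s + t = N →
    ∀ (hZ : (⟨2, 1, ![X 0 ^ N + X 1 ^ N - 1]⟩ : CurveData).IsSmoothAffineCurve)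
      (hω₁ : ∀ l, HasAlgCoeffs ((![X 0 ^ (r - 1) * X 1 ^ s, -(X 0 ^ r * X 1 ^ (s - 1))] :
        Fin 2 → MvPolynomial (Fin 2) ℂ) l))
      (hω₂ : ∀ l, HasAlgCoeffs ((![X 0 ^ (t - 1) * X 1 ^ s, -(X 0 ^ t * X 1 ^ (s - 1))] :
        Fin 2 → MvPolynomial (Fin 2) ℂ) l))
      (hω₃ : ∀ l, HasAlgCoeffs ((![X 0 ^ (r - 1) * X 1 ^ t, -(X 0 ^ r * X 1 ^ (t - 1))] :
        Fin 2 → MvPolynomial (Fin 2) ℂ) l))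
      (γ : CurvePath (⟨2, 1, ![X 0 ^ N + X 1 ^ N - 1]⟩ : CurveData)),
    (∀ u : ℝ, γ.toFun u = ![(((1 - u) * ((1 - u) ^ N + u ^ N) ^ (-(1:ℝ) / N) : ℝ) : ℂ),
      ((u * ((1 - u) ^ N + u ^ N) ^ (-(1:ℝ) / N) : ℝ) : ℂ)]) →
    ∃ (k : ℕ) (ρ : Fin k → (PeriodSymbol →₀ ℂ)) (a : Fin k → ℂ),
      (∀ l, IsElementaryRelation (ρ l)) ∧ (∀ l, IsAlgebraic ℚ (a l)) ∧
      (Finsupp.single (⟨(⟨2, 1, ![X 0 ^ N + X 1 ^ N - 1]⟩ : CurveData), hZ,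
            (![X 0 ^ (r - 1) * X 1 ^ s, -(X 0 ^ r * X 1 ^ (s - 1))] : Fin 2 → MvPolynomial (Fin 2) ℂ), hω₁, γ⟩ :
            PeriodSymbol) (1 : ℂ) -
          (Complex.exp (-(↑Real.pi * Complex.I / (N : ℂ)))) ^ s •
            Finsupp.single (⟨(⟨2, 1, ![X 0 ^ N + X 1 ^ N - 1]⟩ : CurveData), hZ,
              (![X 0 ^ (t - 1) * X 1 ^ s, -(X 0 ^ t * X 1 ^ (s - 1))] : Fin 2 → MvPolynomial (Fin 2) ℂ), hω₂, γ⟩ :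
              PeriodSymbol) (1 : ℂ) -
          (Complex.exp (↑Real.pi * Complex.I / (N : ℂ))) ^ r •
            Finsupp.single (⟨(⟨2, 1, ![X 0 ^ N + X 1 ^ N - 1]⟩ : CurveData), hZ,
              (![X 0 ^ (r - 1) * X 1 ^ t, -(X 0 ^ r * X 1 ^ (t - 1))] : Fin 2 → MvPolynomial (Fin 2) ℂ), hω₃, γ⟩ :
              PeriodSymbol) (1 : ℂ)) =
        ∑ l, a l • ρ l := by
  intro N r s t hN3 hr hs ht hN hZ hω₁ hω₂ hω₃ γ hγ
  have h1 : 1 ≤ N := by omega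
  have hN0 : N ≠ 0 := by omega
  -- the chart facts and the paths
  obtain ⟨hΦ, hcp, hsp, hcm, hsm, hd, he, hf', hg, hh⟩ := stub_sectorChart N hN3
  obtain ⟨e₂, f, e₃, d₃, fI, γ₁, γ₂, he₂, hf, he₃, hd₃, hfI, hγ₁, hγ₂, j1, j2, j3, j4, j5, j6, j7⟩ :=
    stub_sectorPaths N hN3 γ hγ
  -- coordinates of the arc
  have e0 : ∀ u : ℝ, γ.toFun u 0 = (((1 - u) * ((1 - u) ^ N + u ^ N) ^ (-(1:ℝ) / N) : ℝ) : ℂ) := fun u => by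
    rw [hγ u]; rfl
  have e1 : ∀ u : ℝ, γ.toFun u 1 = ((u * ((1 - u) ^ N + u ^ N) ^ (-(1:ℝ) / N) : ℝ) : ℂ) := fun u => by
    rw [hγ u]; rfl
  have hx0 : ∀ u : ℝ, u < 1 → γ.toFun u 0 ≠ 0 := fun u hu => by
    rw [e0]; exact Complex.ofReal_ne_zero.2 (sectorPaths_arcA_pos h1 hu).ne'
  have hy0 : ∀ u : ℝ, 0 < u → γ.toFun u 1 ≠ 0 := fun u hu => by
    rw [e1]; exact Complex.ofReal_ne_zero.2 (sectorPaths_arcB_pos h1 hu).ne'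
  have hεε := sectorChart_eps_mul_epsBar N
  -- the inversion identity used for the transported paths: `ε (ε̄ b / a) / a⁻¹ = b`, `ε̄ (ε a / b) / b⁻¹ = a`
  have hinv₁ : ∀ a b : ℂ, a ≠ 0 → Complex.exp (↑Real.pi * Complex.I / (N : ℂ)) *
      (Complex.exp (-(↑Real.pi * Complex.I / (N : ℂ))) * b / a) / a⁻¹ = b := fun a b ha => by
    calc Complex.exp (↑Real.pi * Complex.I / (N : ℂ)) *
          (Complex.exp (-(↑Real.pi * Complex.I / (N : ℂ))) * b / a) / a⁻¹
        = (Complex.exp (↑Real.pi * Complex.I / (N : ℂ)) * Complex.exp (-(↑Real.pi * Complex.I / (N : ℂ)))) * b *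
            (a * a⁻¹) := by field_simp
      _ = b := by rw [hεε, mul_inv_cancel₀ ha]; ring
  have hinv₂ : ∀ a b : ℂ, b ≠ 0 → Complex.exp (-(↑Real.pi * Complex.I / (N : ℂ))) *
      (Complex.exp (↑Real.pi * Complex.I / (N : ℂ)) * a / b) / b⁻¹ = a := fun a b hb => by
    calc Complex.exp (-(↑Real.pi * Complex.I / (N : ℂ))) *
          (Complex.exp (↑Real.pi * Complex.I / (N : ℂ)) * a / b) / b⁻¹
        = (Complex.exp (↑Real.pi * Complex.I / (N : ℂ)) * Complex.exp (-(↑Real.pi * Complex.I / (N : ℂ)))) * a *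
            (b * b⁻¹) := by field_simp
      _ = a := by rw [hεε, mul_inv_cancel₀ hb]; ring
  -- (1) the loop in the affine chart: `(e₂) + (f) + (e₃) − (γ) ∼ 0` (form `ω_{r,s}`)
  have R1 := stub_sectorLoopZ N h1 _ hsp hcp hΦ hZ _ hω₁ γ e₂ f e₃
    (fun u hu => by
      refine ⟨?_, by rw [e0]; exact (hd u hu).2.1⟩
      conv_lhs => rw [hγ u]
      rw [e0, (hd u hu).1])
    (fun u hu => by
      have hu' : u / 2 ∈ Set.Icc (0:ℝ) (1/2) := ⟨by linarith [hu.1], by linarith [hu.2]⟩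
      have h0 : e₂.toFun u 0 = (γ.toFun (u / 2) 0)⁻¹ := by rw [he₂ u]; rfl
      refine ⟨?_, by rw [h0, e0]; exact (he (u / 2) hu').2⟩
      rw [h0, e0, (he (u / 2) hu').1, he₂ u, e0, e1])
    (fun u hu => by
      have h0 : f.toFun u 0 = ((((2:ℝ) - u) ^ ((N:ℝ)⁻¹) : ℝ) : ℂ) *
          Complex.exp (↑Real.pi * Complex.I * (u : ℂ) / (N : ℂ)) := by rw [hf u]; rfl
      refine ⟨?_, by rw [h0]; exact (hh u hu).1⟩
      rw [h0, hf u])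
    (fun u hu => by
      have hv : (1 + u) / 2 ∈ Set.Icc (1/2:ℝ) 1 := ⟨by linarith [hu.1], by linarith [hu.2]⟩
      have h0 : e₃.toFun u 0 = Complex.exp (↑Real.pi * Complex.I / (N : ℂ)) * γ.toFun ((1 + u) / 2) 0 /
          γ.toFun ((1 + u) / 2) 1 := by rw [he₃ u]; rfl
      refine ⟨?_, by rw [h0, e0, e1]; exact (hf' _ hv).2⟩
      rw [h0, e0, e1, (hf' _ hv).1, he₃ u, e0, e1])
    j1 j2 j3 j4
  -- (2) the loop in the chart at infinity: `(d₃) − (fI) + (γ₂) ∼ 0` (form `ω_{t,s}`)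
  have R2 := stub_sectorLoopInfinity N h1 _ hsm hcm hΦ hZ _ hω₂ γ₂ d₃ fI
    (fun u hu => by
      have hv : (1 + u) / 2 ∈ Set.Icc (0:ℝ) 1 := ⟨by linarith [hu.1], by linarith [hu.2]⟩
      have hv' : (1:ℝ) / 2 ≤ (1 + u) / 2 := by linarith [hu.1]
      have h0 : γ₂.toFun u 0 = γ.toFun ((1 + u) / 2) 0 := by rw [hγ₂ u]
      refine ⟨?_, by rw [h0, e0]; exact ((hd _ hv).2.2 hv')⟩
      rw [h0, e0, (hd _ hv).1, hγ₂ u, hγ])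
    (fun u hu => by
      have hu' : u / 2 ∈ Set.Icc (0:ℝ) (1/2) := ⟨by linarith [hu.1], by linarith [hu.2]⟩
      have h0 : d₃.toFun u 0 = Complex.exp (-(↑Real.pi * Complex.I / (N : ℂ))) * γ.toFun (u / 2) 1 /
          γ.toFun (u / 2) 0 := by rw [hd₃ u]; rfl
      refine ⟨?_, by rw [h0, e0, e1]; exact (hg (u / 2) hu').2⟩
      rw [h0, e0, e1, (hg (u / 2) hu').1, hd₃ u, e0, e1])
    (fun u hu => by
      have h0 : fI.toFun u 0 = (((((2:ℝ) - u) ^ ((N:ℝ)⁻¹) : ℝ) : ℂ) *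
          Complex.exp (↑Real.pi * Complex.I * (u : ℂ) / (N : ℂ)))⁻¹ := by rw [hfI u]; rfl
      refine ⟨?_, by rw [h0]; exact ⟨(hh u hu).2.1, (hh u hu).2.2.1, (hh u hu).2.2.2.1⟩⟩
      rw [h0, ← (hh u hu).2.2.2.2, hfI u])
    (by rw [j5, hγ₂ 1]; norm_num) j6 (by rw [j7, hγ₂ 0]; norm_num)
  -- (3) transport of the branch `e₂` along `g₂`: `(ω_{r,s}, e₂) − ε̄^s (ω_{t,s}, γ₁) ∼ 0`
  have he₂nz : ∀ u ∈ Set.Icc (0:ℝ) 1, e₂.toFun u 0 ≠ 0 := fun u hu => by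
    rw [he₂ u]; exact inv_ne_zero (hx0 _ (by linarith [hu.2]))
  have X1 := stub_transportInvX N r s t hr hs ht hN hZ hω₁ hω₂ e₂ γ₁ he₂nz (fun u hu => by
    have hx := hx0 (u / 2) (by linarith [hu.2])
    rw [hγ₁ u, he₂ u]
    simp only [Matrix.cons_val_zero, Matrix.cons_val_one, inv_inv]
    rw [hinv₁ _ _ hx]
    conv_lhs => rw [show γ.toFun (u / 2) = ![γ.toFun (u / 2) 0, γ.toFun (u / 2) 1] by
      rw [hγ (u/2)]; rfl])
  -- (4) transport of the frontier `f` along `g₂`: `(ω_{r,s}, f) − ε̄^s (ω_{t,s}, fI) ∼ 0`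
  have hfnz : ∀ u ∈ Set.Icc (0:ℝ) 1, f.toFun u 0 ≠ 0 := fun u hu => by
    rw [hf u]; exact sectorPaths_frontier_ne_zero N (by linarith [hu.2])
  have X2 := stub_transportInvX N r s t hr hs ht hN hZ hω₁ hω₂ f fI hfnz (fun u _ => by
    rw [hfI u, hf u]; rfl)
  -- (5) transport of the ray `e₃` along `g₃`: `(ω_{r,s}, e₃) − ε^r (ω_{r,t}, γ₂) ∼ 0`
  have he₃nz : ∀ u ∈ Set.Icc (0:ℝ) 1, e₃.toFun u 1 ≠ 0 := fun u hu => by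
    rw [he₃ u]; exact inv_ne_zero (hy0 _ (by linarith [hu.1]))
  have X3 := stub_transportInvY N r s t hr hs ht hN hZ hω₁ hω₃ e₃ γ₂ he₃nz (fun u hu => by
    have hy := hy0 ((1 + u) / 2) (by linarith [hu.1])
    rw [hγ₂ u, he₃ u]
    simp only [Matrix.cons_val_zero, Matrix.cons_val_one, inv_inv]
    rw [hinv₂ _ _ hy]
    conv_lhs => rw [show γ.toFun ((1 + u) / 2) = ![γ.toFun ((1 + u) / 2) 0, γ.toFun ((1 + u) / 2) 1] by
      rw [hγ ((1 + u) / 2)]; rfl])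
  -- (6) transport of the ray `d₃` at infinity along `g₂ ∘ swap`: `(ω_{t,s}, d₃) + ε̄^t (ω_{r,t}, γ₁) ∼ 0`
  have hd₃nz : ∀ u ∈ Set.Icc (0:ℝ) 1, d₃.toFun u 1 ≠ 0 := fun u hu => by
    rw [hd₃ u]; exact inv_ne_zero (hx0 _ (by linarith [hu.2]))
  have X4 := upperSector_transportInvYX N t s r ht hs hr (by omega) hZ hω₂ hω₃ d₃ γ₁ hd₃nz (fun u hu => by
    have hx := hx0 (u / 2) (by linarith [hu.2])
    rw [hγ₁ u, hd₃ u]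
    simp only [Matrix.cons_val_zero, Matrix.cons_val_one, inv_inv]
    rw [hinv₁ _ _ hx]
    conv_lhs => rw [show γ.toFun (u / 2) = ![γ.toFun (u / 2) 0, γ.toFun (u / 2) 1] by
      rw [hγ (u/2)]; rfl])
  have haB : IsAlgebraic ℚ (Complex.exp (-(↑Real.pi * Complex.I / (N : ℂ))) ^ s) :=
    (sectorPaths_algebraic_epsBar hN0).pow s
  have haE : IsAlgebraic ℚ (Complex.exp (↑Real.pi * Complex.I / (N : ℂ)) ^ r) :=
    (sectorPaths_algebraic_eps hN0).pow r
  have X4s := span_smul haB X4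
  rw [smul_add, smul_smul, upperSector_epsBar_pow_mul hr hN, neg_smul] at X4s
  -- (7) subdivisions of `γ` at `1/2` (forms `ω_{t,s}`, `ω_{r,t}`)
  have hc : (1/2 : ℝ) ∈ Set.Icc (0:ℝ) 1 := ⟨by norm_num, by norm_num⟩
  have hs₁ : ∀ u ∈ Set.Icc (0:ℝ) 1, γ₁.toFun u = γ.toFun (1/2 * u) := fun u _ => by
    rw [hγ₁ u]; congr 1; ring
  have hs₂ : ∀ u ∈ Set.Icc (0:ℝ) 1, γ₂.toFun u = γ.toFun (1/2 + (1 - 1/2) * u) := fun u _ => by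
    rw [hγ₂ u]; congr 1; ring
  have Sub2 := span_of_rel (rel_subdivision hZ _ hω₂ γ γ₁ γ₂ hc hs₁ hs₂)
  have Sub3 := span_of_rel (rel_subdivision hZ _ hω₃ γ γ₁ γ₂ hc hs₁ hs₂)
  -- (8) assemble
  obtain ⟨k, ρ, a, hρ, ha, hfin⟩ := span_sub (span_sub (span_add (span_add (span_add (span_add (span_add X1 X2) X3)
    X4s) (span_smul haB Sub2)) (span_smul haE Sub3)) R1) (span_smul haB R2)
  exact ⟨k, ρ, a, hρ, ha, by rw [← hfin]; module⟩

end Summit.KontsevichZagierPeriods.FermatIsogeny.BetaLinearSector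

end
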